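/-
Copyright (c) 2026 the pub-hodgecm-mathlib formalisation cell (harness21).  Prover seat hodgecm-mathlib-LH1-p01 (g5): line LH4 bankable brick
(J1) «QUADRATIC PLACE NORM INDEX TWO» (LH4-plan (g3) DEALER WORD #29, after LH5-p02 (g3)'s (b1) NORM-INDEX-TWO census); 2026-09-02.
-/
import Literature.NumberTheory.GaloisRepresentations.LocalClassFieldAxiom   -- ★ `index_range_unitsMap_norm_eq_finrank` (Neukirch V (1.1) `i = 0`, Herbrand road, LCFT-free)
import Literature.NumberTheory.LocalFields.QuadraticLocalNormFixedRange      -- ★ (J2) `stabilizer_place_eq_top_of_card_eq_two`, `finrank_place_eq_two`; brings ★ `SemiLocalShapiro` (`decompMulEquiv`, `isGalois_place`, `isPretransitive_place`)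
import Literature.NumberTheory.Automorphic.AdicCompletionLocalField          -- ★ instances `ValuativeRel ∕ IsNonarchimedeanLocalField (v.adicCompletion F)`
import Mathlib.GroupTheory.SpecificGroups.Cyclic                             -- `isCyclic_of_prime_card`, `isCyclic_of_surjective`, `Subgroup.isCyclic`
import HarnessLib

/-!
# The local norm index `[F_vˣ : N_{E_w ∕ F_v} E_wˣ]` at a place of a quadratic extension of number fields: `2` non-split, `1` split
# (Neukirch ANT V (1.1) `i = 0` through the decomposition group; Cassels–Fröhlich VII §1.1)

Topic `NumberTheory/LocalFields`; namespace `Literature.NumberTheory.LocalFields`.  THEOREMS ONLY (no definition, no instance, no notation, no named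
fact, no `sorry`).  Cell `pub/hodgecm-mathlib` (D-0151), crux H413 = `stmt-HodgeConjecture-24833`, line LH4 (dyadic ∕ wild pay-down road of
`stub_N6nsDyadic`): the JUNCTION (J1) of LH5-p02 (g3)'s (b1) «NORM INDEX TWO» census (`F0/P3c/LH5/LH5-p02/g3/NORM-INDEX-TWO-CENSUS.md` §2) between the
tree's LCFT-free class field axiom ★ `Literature.NumberTheory.GaloisRepresentations.index_range_unitsMap_norm_eq_finrank` (abstract non-archimedean local
field `K`, cyclic `L ∕ K`: `[Kˣ : N Lˣ] = [L : K]`, Herbrand quotient + Hilbert 90, no reciprocity map) and the `Place`-currency of the semi-local files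
(★ `SemiLocal.decompMulEquiv : Stab(w) ≃* Gal(E_w ∕ F_v)`, ★ `SemiLocal.isGalois_place`, ★ `SemiLocal.finrank_place_eq_card_stabilizer`), so that every
σ_w-currency consumer of line LH4 (★ (J2) `QuadraticLocalNormFixedRange`, ★ `QuadraticNormIndexFiniteCM`, the ‹U-FIN-wild› class count) can name the index
at a WILD place as well: the Herbrand road never looks at ramification.
HONEST LABEL: HC_CM is proved only modulo the 7 printed citations (2 remaining: hLiu418 24832, h413 24833) until rung 0 closes; this file is unconditional
local algebra, count-neutral (`--supports stmt-HodgeConjecture-24833`).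

SETTING (as ★ (J2)).  `E ∕ F` a finite Galois extension of number fields (`F E : Type`), `v` a finite place of `F`, `w : SemiLocal.Place F E v` (the subtype
`{w // w.under (𝓞 F) = v}` = `UnitaryGroup.PlacesOver E v`), `F_v = v.adicCompletion F` — a non-archimedean local field by ★ `instIsNonarchimedeanLocalFieldAdicCompletion` —
and `E_w = (w : HeightOneSpectrum (𝓞 E)).adicCompletion E` with the ★ algebra structure `SemiLocal.algebraPlace w`.  The index is that of the subgroup
`N_{E_w∕F_v}(E_wˣ) = (Units.map (Algebra.norm F_v : E_w →* F_v)).range ≤ F_vˣ` (the axiom's spelling).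

* §1 (any finite Galois `E ∕ F`, any `w ∣ v` with CYCLIC decomposition group — e.g. every unramified `w`, every `w` when `Gal(E∕F)` is cyclic):
  **`index_range_norm_place_eq_finrank_of_isCyclic`** `[F_vˣ : N E_wˣ] = [E_w : F_v]` and **`index_range_norm_place_eq_card_stabilizer_of_isCyclic`** `= #Stab(w)`.
* §2 (`#Gal(E∕F) = 2`): `index_range_norm_place_eq_card_stabilizer_of_card_eq_two` (`= #Stab(w)` at EVERY `w`); NON-SPLIT: `stabilizer_place_eq_top_of_subsingleton`,
  **`index_range_norm_place_eq_two`** (`Subsingleton (Place F E v)` frame — LH4's `hsub`), **`index_range_norm_place_eq_two_of_smul_eq`** (`c ≠ 1`, `c • w = w` frame — (J2)'s);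
  SPLIT: `card_stabilizer_place_eq_one_of_nontrivial`, `finrank_place_eq_one_of_nontrivial`, **`index_range_norm_place_eq_one_of_nontrivial`**, `range_norm_place_eq_top_of_nontrivial`.
* §3 (CM fields `L ∕ L⁺`, `c = IsCMField.complexConj L`): **`IsCMField.index_range_norm_place_eq_two`** (`complexConj L • w = w`), `IsCMField.index_range_norm_place_eq_two_of_subsingleton`,
  `IsCMField.index_range_norm_place_eq_one_of_smul_ne` (`complexConj L • w ≠ w`).
USAGE from `UnitaryGroup.PlacesOver` currency: as ★ (J2) — pass `w : UnitaryGroup.PlacesOver L v` ITSELF for the `Place` argument (same subtype); `hsub : Subsingleton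
(UnitaryGroup.PlacesOver L v)` is `Subsingleton (SemiLocal.Place L⁺ L v)` by `exact hsub` (definitional unfolding of the `def`).

TWIN IN THE TREE (cited, not restated): ★ `Literature.NumberTheory.NumberFields.index_range_norm_place_eq_finrank` (`ArtinMapLocalNormKernel`, Lang XI §4 Thm. 3) proves
`[K_vˣ : N L_wˣ] = [L_w : K_v]` for `L : IntermediateField K (AlgebraicClosure K)` abelian over `K` through GLOBAL Artin reciprocity; the present file is its
abstract-`Algebra F E`, reciprocity-free counterpart for cyclic decomposition groups (the currency of the CM consumers, `Algebra L⁺ L`).  ★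
`SemiLocal.isCyclic_gal_place_of_isCyclic` (`LocalNormQuotientCyclicPlace`, cell bsd-print-cf2) is the cyclicity transport used in §1, re-derived inline in one
line to keep the local-reciprocity cone (`LocalNormQuotientCyclic`) out of this file's imports.

## References
* J. Neukirch, *Algebraic Number Theory*, Grundlehren 322 (1999), Ch. V §1 Thm. (1.1) (the class field axiom `#H⁰(G(L|K), L^*) = [L : K]` for cyclic `L|K`),
  Ch. II (9.6) (`G_w ≅ G(L_w|K_v)`). [NeukirchANT1999]
* J. W. S. Cassels, A. Fröhlich (eds.), *Algebraic Number Theory* (1967), Ch. VII (J. Tate) §1.1 («`G_w` is the Galois group of `L_w∕K_v`»), Ch. VI (J.-P. Serre) §1.1. [CasselsFrohlichANT1967]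
* J.-P. Serre, *Local Fields*, GTM 67 (1979), Ch. XIII §4 (norm index of a cyclic extension via the Herbrand quotient). [Serre1979]

## Tree search
`lean search 'index_range_norm_place|norm_place_eq_two|card_stabilizer_place_eq_one'`: only ★ `NumberFields.index_range_norm_place_eq_finrank` ∕ `…_eq_ramificationIdxIn_mul_inertiaDegIn`
(intermediate-field currency, see TWIN).  Inputs: ★ `index_range_unitsMap_norm_eq_finrank`, ★ `SemiLocal.decompMulEquiv`, `SemiLocal.isGalois_place`, `SemiLocal.finiteDimensional_place`,
`SemiLocal.finrank_place_eq_card_stabilizer`, `SemiLocal.isPretransitive_place`, `SemiLocal.Place.ext ∕ coe_smul`, ★ (J2) `stabilizer_place_eq_top_of_card_eq_two`; Mathlib `isCyclic_of_prime_card`,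
`isCyclic_of_surjective`, `Subgroup.isCyclic`, `Subgroup.index_mul_card`, `MulAction.index_stabilizer_of_transitive`, `Subgroup.card_eq_one`, `Subgroup.index_eq_one`,
`IsGalois.card_aut_eq_finrank`, `Algebra.IsQuadraticExtension.finrank_eq_two`, `NumberField.IsCMField.complexConj_ne_one`.
-/

namespace Literature.NumberTheory.LocalFields

open NumberField IsDedekindDomain
open Literature.NumberTheory.Automorphic Literature.NumberTheory.GaloisRepresentations
open Literature.NumberTheory.GaloisRepresentations.SemiLocal

variable {F : Type} [Field F] [NumberField F] {E : Type} [Field E] [NumberField E] [Algebra F E]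
variable {v : HeightOneSpectrum (𝓞 F)}

/-! ## §1 Any finite Galois `E ∕ F`: a place with cyclic decomposition group -/

/-- **`[F_vˣ : N_{E_w∕F_v} E_wˣ] = [E_w : F_v]` at a place `w ∣ v` with CYCLIC decomposition group** (Neukirch's class field axiom V (1.1), `i = 0`, for the
cyclic local layer `E_w ∕ F_v`: its Galois group is `Stab(w)` through ★ `decompMulEquiv`, `E_w ∕ F_v` is Galois by ★ `isGalois_place`, and `F_v` is a
non-archimedean local field by ★ `instIsNonarchimedeanLocalFieldAdicCompletion`; the index is Herbrand quotient + Hilbert 90 — NO reciprocity, NO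
ramification hypothesis). [cite: NeukirchANT1999, Ch. V §1 Thm. (1.1); Ch. II (9.6)] [cite: CasselsFrohlichANT1967, Ch. VII §1.1] -/
theorem index_range_norm_place_eq_finrank_of_isCyclic [IsGalois F E] (w : Place F E v)
    (hcyc : IsCyclic (MulAction.stabilizer (E ≃ₐ[F] E) w)) :
    (Units.map (Algebra.norm (v.adicCompletion F) :
        (w : HeightOneSpectrum (𝓞 E)).adicCompletion E →* v.adicCompletion F)).range.index =
      Module.finrank (v.adicCompletion F) ((w : HeightOneSpectrum (𝓞 E)).adicCompletion E) := by
  haveI := finiteDimensional_place (K := F) w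
  haveI := isGalois_place (F := F) w
  haveI := hcyc
  -- `Gal(E_w ∕ F_v)` is cyclic, being the image of `Stab(w)` under ★ `decompMulEquiv` (= ★ `SemiLocal.isCyclic_gal_place_of_isCyclic`, inline)
  haveI : IsCyclic (((w : HeightOneSpectrum (𝓞 E)).adicCompletion E) ≃ₐ[v.adicCompletion F]
      ((w : HeightOneSpectrum (𝓞 E)).adicCompletion E)) :=
    isCyclic_of_surjective (decompMulEquiv w) (decompMulEquiv w).surjective
  exact index_range_unitsMap_norm_eq_finrank (v.adicCompletion F) ((w : HeightOneSpectrum (𝓞 E)).adicCompletion E)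

/-- **`[F_vˣ : N_{E_w∕F_v} E_wˣ] = #Stab(w)`** at a place with cyclic decomposition group (`[E_w : F_v] = #Stab(w)`, ★ `finrank_place_eq_card_stabilizer`).
[cite: NeukirchANT1999, Ch. V §1 Thm. (1.1); Ch. II (9.6)] [cite: CasselsFrohlichANT1967, Ch. VII §1.1–1.2] -/
theorem index_range_norm_place_eq_card_stabilizer_of_isCyclic [IsGalois F E] (w : Place F E v)
    (hcyc : IsCyclic (MulAction.stabilizer (E ≃ₐ[F] E) w)) :
    (Units.map (Algebra.norm (v.adicCompletion F) :
        (w : HeightOneSpectrum (𝓞 E)).adicCompletion E →* v.adicCompletion F)).range.index =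
      Nat.card (MulAction.stabilizer (E ≃ₐ[F] E) w) := by
  rw [index_range_norm_place_eq_finrank_of_isCyclic w hcyc, finrank_place_eq_card_stabilizer w]

/-! ## §2 Quadratic `E ∕ F` (`#Gal(E∕F) = 2`): the index is `#Stab(w)` — `2` at a non-split place, `1` at a split place -/

section Quadratic

variable [IsGalois F E] (hG : Nat.card (E ≃ₐ[F] E) = 2)

include hG

/-- **Quadratic `E ∕ F`, any place `w ∣ v`: `[F_vˣ : N_{E_w∕F_v} E_wˣ] = #Stab(w)`** (`Gal(E∕F)` of prime order `2` is cyclic, hence so is every decomposition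
group). [cite: NeukirchANT1999, Ch. V §1 Thm. (1.1); Ch. II (9.6)] -/
theorem index_range_norm_place_eq_card_stabilizer_of_card_eq_two (w : Place F E v) :
    (Units.map (Algebra.norm (v.adicCompletion F) :
        (w : HeightOneSpectrum (𝓞 E)).adicCompletion E →* v.adicCompletion F)).range.index =
      Nat.card (MulAction.stabilizer (E ≃ₐ[F] E) w) := by
  haveI : IsCyclic (E ≃ₐ[F] E) := isCyclic_of_prime_card hG
  exact index_range_norm_place_eq_card_stabilizer_of_isCyclic w inferInstance

omit [IsGalois F E] hG in
/-- At a place `v` with a SINGLE place `w` of `E` above it, the decomposition group is everything (every `g` maps `w` to a place above `v`, i.e. to `w`).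
[cite: CasselsFrohlichANT1967, Ch. VII §1.1] -/
theorem stabilizer_place_eq_top_of_subsingleton (w : Place F E v) (hsub : Subsingleton (Place F E v)) :
    MulAction.stabilizer (E ≃ₐ[F] E) w = ⊤ :=
  eq_top_iff.mpr fun g _ => MulAction.mem_stabilizer_iff.mpr (Subsingleton.elim (g • w) w)

/-- **(J1) `[F_vˣ : N_{E_w∕F_v} E_wˣ] = 2` at a NON-SPLIT place of a quadratic extension** — unramified, tame or WILD alike — in the `Subsingleton`-frame of the
LH4 consumers (`hsub : Subsingleton (PlacesOver E v)`): `Stab(w) = Gal(E∕F)` has order `2`, and §1 applies. [cite: NeukirchANT1999, Ch. V §1 Thm. (1.1); Ch. II (9.6)]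
[cite: CasselsFrohlichANT1967, Ch. VII §1.1] -/
theorem index_range_norm_place_eq_two (w : Place F E v) (hsub : Subsingleton (Place F E v)) :
    (Units.map (Algebra.norm (v.adicCompletion F) :
        (w : HeightOneSpectrum (𝓞 E)).adicCompletion E →* v.adicCompletion F)).range.index = 2 := by
  rw [index_range_norm_place_eq_card_stabilizer_of_card_eq_two hG w, stabilizer_place_eq_top_of_subsingleton w hsub,
    Subgroup.card_top, hG]

/-- **(J1′) `[F_vˣ : N_{E_w∕F_v} E_wˣ] = 2` at a place fixed by the non-trivial automorphism `c` of a quadratic extension** (★ (J2)'s frame `c ≠ 1`,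
`c • w = w`: then `Stab(w) = ⊤`, ★ `stabilizer_place_eq_top_of_card_eq_two`). [cite: NeukirchANT1999, Ch. V §1 Thm. (1.1); Ch. II (9.6)] [cite: CasselsFrohlichANT1967, Ch. VII §1.1] -/
theorem index_range_norm_place_eq_two_of_smul_eq (w : Place F E v) {c : E ≃ₐ[F] E} (hc : c ≠ 1)
    (hw : c • (w : HeightOneSpectrum (𝓞 E)) = w) :
    (Units.map (Algebra.norm (v.adicCompletion F) :
        (w : HeightOneSpectrum (𝓞 E)).adicCompletion E →* v.adicCompletion F)).range.index = 2 := by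
  rw [index_range_norm_place_eq_card_stabilizer_of_card_eq_two hG w, stabilizer_place_eq_top_of_card_eq_two hG w hc hw,
    Subgroup.card_top, hG]

/-- **At a SPLIT place of a quadratic extension (two places above `v`) the decomposition group is trivial**: `Gal(E∕F)` is transitive on the places above
`v` (★ `isPretransitive_place`), so `#{w' ∣ v} · #Stab(w) = #Gal(E∕F) = 2` (orbit–stabilizer) with `#{w' ∣ v} ≥ 2`. [cite: CasselsFrohlichANT1967, Ch. VII §1.1–1.2 (Prop. 1.2 (ii))] -/
theorem card_stabilizer_place_eq_one_of_nontrivial (w : Place F E v) (hnt : Nontrivial (Place F E v)) :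
    Nat.card (MulAction.stabilizer (E ≃ₐ[F] E) w) = 1 := by
  haveI := isPretransitive_place (F := F) (E := E) (v := v)
  haveI := hnt
  -- orbit–stabilizer: `#{w' ∣ v} · #Stab(w) = #Gal(E∕F) = 2`
  have hmul : Nat.card (Place F E v) * Nat.card (MulAction.stabilizer (E ≃ₐ[F] E) w) = 2 := by
    rw [← MulAction.index_stabilizer_of_transitive (E ≃ₐ[F] E) w, Subgroup.index_mul_card, hG]
  have h2 : 2 ≤ Nat.card (Place F E v) := Finite.one_lt_card
  have hpos : 0 < Nat.card (MulAction.stabilizer (E ≃ₐ[F] E) w) := Nat.card_pos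
  have hle : 2 * Nat.card (MulAction.stabilizer (E ≃ₐ[F] E) w) ≤
      Nat.card (Place F E v) * Nat.card (MulAction.stabilizer (E ≃ₐ[F] E) w) :=
    Nat.mul_le_mul_right _ h2
  rw [hmul] at hle
  omega

/-- **`[E_w : F_v] = 1` at a split place of a quadratic extension** (`= #Stab(w) = 1`, ★ `finrank_place_eq_card_stabilizer`).
[cite: CasselsFrohlichANT1967, Ch. VII §1.1–1.2] [cite: NeukirchANT1999, Ch. II (9.6)] -/
theorem finrank_place_eq_one_of_nontrivial (w : Place F E v) (hnt : Nontrivial (Place F E v)) :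
    Module.finrank (v.adicCompletion F) ((w : HeightOneSpectrum (𝓞 E)).adicCompletion E) = 1 := by
  rw [finrank_place_eq_card_stabilizer w, card_stabilizer_place_eq_one_of_nontrivial hG w hnt]

/-- **`[F_vˣ : N_{E_w∕F_v} E_wˣ] = 1` at a SPLIT place of a quadratic extension** (the split twin of (J1): `E_w = F_v`, every element is a norm).
[cite: NeukirchANT1999, Ch. V §1 Thm. (1.1); Ch. II (9.6)] [cite: CasselsFrohlichANT1967, Ch. VII §1.1–1.2] -/
theorem index_range_norm_place_eq_one_of_nontrivial (w : Place F E v) (hnt : Nontrivial (Place F E v)) :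
    (Units.map (Algebra.norm (v.adicCompletion F) :
        (w : HeightOneSpectrum (𝓞 E)).adicCompletion E →* v.adicCompletion F)).range.index = 1 := by
  rw [index_range_norm_place_eq_card_stabilizer_of_card_eq_two hG w, card_stabilizer_place_eq_one_of_nontrivial hG w hnt]

/-- At a split place of a quadratic extension **the local norm is surjective on units: `N_{E_w∕F_v}(E_wˣ) = F_vˣ`** (index `1`).
[cite: NeukirchANT1999, Ch. V §1 Thm. (1.1); Ch. II (9.6)] -/
theorem range_norm_place_eq_top_of_nontrivial (w : Place F E v) (hnt : Nontrivial (Place F E v)) :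
    (Units.map (Algebra.norm (v.adicCompletion F) :
        (w : HeightOneSpectrum (𝓞 E)).adicCompletion E →* v.adicCompletion F)).range = ⊤ :=
  Subgroup.index_eq_one.mp (index_range_norm_place_eq_one_of_nontrivial hG w hnt)

end Quadratic

/-! ## §3 CM fields `L ∕ L⁺`: the consumers' spelling (`IsCMField.complexConj L`, `UnitaryGroup.PlacesOver L v = SemiLocal.Place L⁺ L v`) -/

section CM

variable (L : Type) [Field L] [NumberField L] [IsCMField L] {v : HeightOneSpectrum (𝓞 ↥(maximalRealSubfield L))}
  (w : Place ↥(maximalRealSubfield L) L v)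

/-- `#Gal(L ∕ L⁺) = 2` for a CM field `L` (Mathlib: `L ∕ L⁺` is a Galois quadratic extension). [folklore] -/
private theorem IsCMField.natCard_algEquiv_eq_two' : Nat.card (L ≃ₐ[↥(maximalRealSubfield L)] L) = 2 := by
  rw [IsGalois.card_aut_eq_finrank, Algebra.IsQuadraticExtension.finrank_eq_two]

/-- **`[L⁺_vˣ : N_{L_w∕L⁺_v} L_wˣ] = 2` at a place `w` of the CM field `L` fixed by complex conjugation** (NON-SPLIT in `L ∕ L⁺`: inert, tamely or WILDLY
ramified alike) — the σ_w-currency hypothesis `hw : IsCMField.complexConj L • w = w` of the LH4 files. [cite: NeukirchANT1999, Ch. V §1 Thm. (1.1); Ch. II (9.6)]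
[cite: CasselsFrohlichANT1967, Ch. VII §1.1] -/
theorem IsCMField.index_range_norm_place_eq_two (hw : IsCMField.complexConj L • (w : HeightOneSpectrum (𝓞 L)) = w) :
    (Units.map (Algebra.norm (v.adicCompletion ↥(maximalRealSubfield L)) :
        (w : HeightOneSpectrum (𝓞 L)).adicCompletion L →* v.adicCompletion ↥(maximalRealSubfield L))).range.index = 2 :=
  index_range_norm_place_eq_two_of_smul_eq (IsCMField.natCard_algEquiv_eq_two' L) w (IsCMField.complexConj_ne_one L) hw

/-- **`[L⁺_vˣ : N_{L_w∕L⁺_v} L_wˣ] = 2` when `w` is the ONLY place of `L` above `v`** (the `hsub : Subsingleton (UnitaryGroup.PlacesOver L v)` frame of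
★ `ShalikaGermExpansionUnitaryThreeNonsplitCM` and the LH4 leaf). [cite: NeukirchANT1999, Ch. V §1 Thm. (1.1); Ch. II (9.6)] [cite: CasselsFrohlichANT1967, Ch. VII §1.1] -/
theorem IsCMField.index_range_norm_place_eq_two_of_subsingleton (hsub : Subsingleton (Place ↥(maximalRealSubfield L) L v)) :
    (Units.map (Algebra.norm (v.adicCompletion ↥(maximalRealSubfield L)) :
        (w : HeightOneSpectrum (𝓞 L)).adicCompletion L →* v.adicCompletion ↥(maximalRealSubfield L))).range.index = 2 :=
  LocalFields.index_range_norm_place_eq_two (IsCMField.natCard_algEquiv_eq_two' L) w hsub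

/-- **`[L⁺_vˣ : N_{L_w∕L⁺_v} L_wˣ] = 1` at a place `w` of the CM field `L` MOVED by complex conjugation** (SPLIT in `L ∕ L⁺`: `w̄ ≠ w` are two places above `v`).
[cite: NeukirchANT1999, Ch. V §1 Thm. (1.1); Ch. II (9.6)] [cite: CasselsFrohlichANT1967, Ch. VII §1.1–1.2] -/
theorem IsCMField.index_range_norm_place_eq_one_of_smul_ne (hw : IsCMField.complexConj L • (w : HeightOneSpectrum (𝓞 L)) ≠ w) :
    (Units.map (Algebra.norm (v.adicCompletion ↥(maximalRealSubfield L)) :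
        (w : HeightOneSpectrum (𝓞 L)).adicCompletion L →* v.adicCompletion ↥(maximalRealSubfield L))).range.index = 1 :=
  index_range_norm_place_eq_one_of_nontrivial (IsCMField.natCard_algEquiv_eq_two' L) w
    ⟨⟨IsCMField.complexConj L • w, w, fun h => hw (congrArg Place.val h)⟩⟩

end CM

end Literature.NumberTheory.LocalFields
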